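import Summits.SmoothPoincare4.SmoothPoincare4.Theorems.SullivanDualWitnessChargeHelperEndHolomorphic
import Summits.SmoothPoincare4.SmoothPoincare4.Theorems.SullivanDualWitnessChargeHelperMemberGraphFunction
import Summits.SmoothPoincare4.SmoothPoincare4.Theorems.SullivanDualWitnessChargeHelperMemberEventuallyInBall
import Summits.SmoothPoincare4.SmoothPoincare4.Theorems.SullivanDualWitnessChargeHelperDecayAtInfinity
import Summits.SmoothPoincare4.SmoothPoincare4.Theorems.SullivanDualWitnessChargeHelperUnivalentOfDecay
import Summits.SmoothPoincare4.SmoothPoincare4.Theorems.SullivanDualWitnessChargeStubBubbleConfinementHolomorphic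
import Literature.Analysis.Complex.AreaTheorem

/-!
# Helper `helper_memberGraph_of` of line `Sketch` (pencil-incompleteness) for crux `WitnessCharge`
(item stmt-SmoothPoincare4-7824; route `SullivanDual`, crux
`Summit.SmoothPoincare4.SmoothPoincare4.Theses.SullivanDual.WitnessCharge`; line `Sketch`,
stub `helper_memberGraph_of` — confinement step (P3)(a): a pencil member is a graph over the
exterior of a disc, given degree theory)

Let `u : ℂ → Σ∖p` be a pencil member (`IsPencilMember J u b`) for `J` standard on the punctured
`ε'`-chart-ball `B_{ε'}` at `p`, and write `U = u⁻¹(B_{ε'})`, `Z ξ = (Ycoord p (u ξ)).1` (the first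
complex flat coordinate), `U_R = {ξ ∈ U | R < ‖Z ξ‖}`, `A_R = {z | R < ‖z‖}` for `R > ε'⁻¹`.
GIVEN the degree-theoretic statement "a relatively proper holomorphic map `Z : U → A` onto a
preconnected open `A` with one simple single-point fibre is bijective with `Z' ≠ 0`" as a
hypothesis (it is the lead's `helper_properHolo_degreeOne`), we verify its seven inputs for
`Z, U_R, A_R`:

* `U_R` is open and `Z` is holomorphic on it (`helper_endHolomorphic`, E0); `A_R` is open and
  preconnected (`Literature.Analysis.Complex.AreaThm.isConnected_setOf_lt_norm`); `Z(U_R) ⊆ A_R`;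
* RELATIVE PROPERNESS (`MemberGraph.isCompact_inter_preimage_of_subset`): for compact `K ⊆ A_R`
  the set `U_R ∩ Z⁻¹ K` is bounded (`Z ξ − ξ → 0` at infinity, fifth clause of `IsPencilMember`) and
  closed: on it `‖e(u ξ) − e p‖ = ‖realify (Ycoord p (u ξ))‖⁻¹ < R⁻¹ < ε'`
  (`inBall_of_inv_lt_norm_fst_Ycoord` of the sibling file
  `SullivanDualWitnessChargeHelperMemberGraphFunction.lean`), so it equals `C ∩ Z⁻¹ K` for the
  closed set `C = u⁻¹(closed chart ball of radius R⁻¹) ⊆ U` (`isClosed_closedChartBall`), on which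
  `Z` is continuous;
* DEGREE-ONE POINT (`MemberGraph.exists_simpleFibre_of_tendsto`): `u` eventually enters `B_{ε'}`
  (`helper_memberEventuallyInBall`), so `g = Z − id` is holomorphic near infinity and tends to `0`;
  the decay estimates (`helper_decayAtInfinity`) feed `helper_univalentOfDecay`, which makes `Z`
  co-Lipschitz on `{r' < ‖ξ‖}` with image containing `{2r' < ‖z‖}`; on `U ∩ {‖ξ‖ ≤ r'}` the
  coordinate `Z` is bounded (`exists_norm_fst_Ycoord_le_of_norm_le` of the sibling file: the
  compact set `u(closedBall 0 r')` misses a punctured chart-ball), so a far real value `a₀` has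
  exactly one preimage, at which `Z' ≠ 0` because a co-Lipschitz map cannot have zero derivative
  (`MemberGraph.deriv_ne_zero_of_coLipschitz`).

The auxiliary lemmas live in the sub-namespace `MemberGraph` (no clash with sibling helper files).

References: M. Gromov, *Pseudo holomorphic curves in symplectic manifolds*, Invent. Math. 82
(1985), §2.4.A [Gromov1985].
-/

noncomputable section

-- the registered namespace `Summit.SmoothPoincare4.SmoothPoincare4.…` repeats a component
set_option linter.dupNamespace false

open scoped Manifold ContDiff Topology
open Set Filter Literature.Geometry.Kaehler Literature.Geometry.Symplectic
  Literature.Topology.FourManifolds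

namespace Summit.SmoothPoincare4.SmoothPoincare4.Theorems.WitnessCharge.PencilIncompleteness

namespace MemberGraph

/-! ### One-variable complex analysis: co-Lipschitz maps and the simple far fibre -/

section Analysis

/-- A map which is co-Lipschitz near `ξ₀` (`‖ξ − ξ₀‖ ≤ 2 ‖Z ξ − Z ξ₀‖` on a neighbourhood of `ξ₀`
in `{r' < ‖ξ‖}`) and complex differentiable at `ξ₀` has nonzero derivative there: otherwise
`‖Z ξ − Z ξ₀‖ ≤ ‖ξ − ξ₀‖ / 4` near `ξ₀` would force `ξ = ξ₀` on a punctured neighbourhood. -/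
theorem deriv_ne_zero_of_coLipschitz {Z : ℂ → ℂ} {r' : ℝ} {ξ₀ : ℂ}
    (hco : ∀ ξ ξ' : ℂ, r' < ‖ξ‖ → r' < ‖ξ'‖ → ‖ξ - ξ'‖ ≤ 2 * ‖Z ξ - Z ξ'‖)
    (hξ₀ : r' < ‖ξ₀‖) (hZ : DifferentiableAt ℂ Z ξ₀) : deriv Z ξ₀ ≠ 0 := by
  intro hd0
  have hD : HasDerivAt Z 0 ξ₀ := hd0 ▸ hZ.hasDerivAt
  have h1 := (hasDerivAt_iff_isLittleO.1 hD).def (by norm_num : (0 : ℝ) < 1 / 4)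
  have h2 : ∀ᶠ x in 𝓝 ξ₀, r' < ‖x‖ := (isOpen_lt continuous_const continuous_norm).mem_nhds hξ₀
  have h3 : ∀ᶠ x in 𝓝 ξ₀, x = ξ₀ := by
    filter_upwards [h1, h2] with x hx hx'
    rw [smul_zero, sub_zero] at hx
    have h4 := hco x ξ₀ hx' hξ₀
    have h5 : ‖x - ξ₀‖ ≤ 0 := by linarith
    exact sub_eq_zero.1 (norm_le_zero_iff.1 h5)
  have h6 : ∀ᶠ x in 𝓝[≠] ξ₀, x = ξ₀ := nhdsWithin_le_nhds h3
  obtain ⟨x, hx, hx'⟩ := (h6.and self_mem_nhdsWithin).exists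
  exact hx' hx

/-- **The simple far fibre.** Let `U ⊆ ℂ` be open and contain `{r < ‖ξ‖}`, `Z` holomorphic on `U`
with `Z ξ − ξ → 0` at infinity and `Z` bounded on every `U ∩ closedBall 0 ρ`. Then for every real
`R` there is a value `a₀` with `R < ‖a₀‖` having exactly one preimage `ξ₀ ∈ U`, and
`deriv Z ξ₀ ≠ 0`. (Decay of `Z − id` at infinity, `helper_decayAtInfinity`; univalence near
infinity, `helper_univalentOfDecay`; a far real `a₀` beyond the bound of `Z` on the compact
part.) -/
theorem exists_simpleFibre_of_tendsto {Z : ℂ → ℂ} {U : Set ℂ} {r : ℝ} (hU : IsOpen U)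
    (hZ : DifferentiableOn ℂ Z U) (hrU : ∀ ξ : ℂ, r < ‖ξ‖ → ξ ∈ U)
    (hlim : Tendsto (fun ξ : ℂ => Z ξ - ξ) (cocompact ℂ) (𝓝 0))
    (hbdd : ∀ ρ : ℝ, ∃ B : ℝ, ∀ ξ ∈ U, ‖ξ‖ ≤ ρ → ‖Z ξ‖ ≤ B) (R : ℝ) :
    ∃ a₀ : ℂ, R < ‖a₀‖ ∧ ∃ ξ₀ ∈ U, Z ξ₀ = a₀ ∧ deriv Z ξ₀ ≠ 0 ∧
      ∀ ξ ∈ U, Z ξ = a₀ → ξ = ξ₀ := by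
  -- differentiability of `Z` and of `g = Z - id` beyond radius `r`
  have hZat : ∀ ξ : ℂ, r < ‖ξ‖ → DifferentiableAt ℂ Z ξ := fun ξ hξ =>
    hZ.differentiableAt (hU.mem_nhds (hrU ξ hξ))
  have hgdiff : DifferentiableOn ℂ (fun ξ : ℂ => Z ξ - ξ) {ξ : ℂ | r < ‖ξ‖} :=
    (hZ.mono fun ξ hξ => hrU ξ hξ).sub differentiableOn_id
  have hderiv : ∀ ξ : ℂ, r < ‖ξ‖ → deriv (fun y : ℂ => Z y - y) ξ = deriv Z ξ - 1 := fun ξ hξ =>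
    ((hZat ξ hξ).hasDerivAt.sub (hasDerivAt_id' ξ)).deriv
  -- decay of `g` and univalence of `Z` near infinity
  obtain ⟨C, r₁, _hr₁, hrr₁, hdec⟩ := helper_decayAtInfinity (fun ξ : ℂ => Z ξ - ξ) r hgdiff hlim
  obtain ⟨r', hr', hco, hsurj⟩ := helper_univalentOfDecay Z C (r₁ + 1) (by linarith)
    (hZ.mono fun ξ hξ => hrU ξ (by simp only [mem_setOf_eq] at hξ; linarith)) (fun ξ hξ => by
      refine ⟨(hdec ξ (by linarith)).1, ?_⟩
      rw [← hderiv ξ (by linarith)]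
      exact (hdec ξ (by linarith)).2)
  -- a bound for `Z` on `U ∩ closedBall 0 r'` and a far real value `a₀`
  obtain ⟨B, hB⟩ := hbdd r'
  obtain ⟨a, ha⟩ : ∃ a : ℝ, a = max (max (2 * r') B) R + 1 := ⟨_, rfl⟩
  have h2r : 2 * r' < a := by
    rw [ha]; linarith [le_max_left (2 * r') B, le_max_left (max (2 * r') B) R]
  have hBa : B < a := by
    rw [ha]; linarith [le_max_right (2 * r') B, le_max_left (max (2 * r') B) R]
  have hRa : R < a := by rw [ha]; linarith [le_max_right (max (2 * r') B) R]
  have hapos : 0 < a := by linarith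
  have hnorm : ‖(a : ℂ)‖ = a := by rw [Complex.norm_real, Real.norm_of_nonneg hapos.le]
  obtain ⟨ξ₀, hξ₀, hZξ₀⟩ := hsurj (show 2 * r' < ‖(a : ℂ)‖ by rwa [hnorm])
  have hξ₀r : r < ‖ξ₀‖ := by simp only [mem_setOf_eq] at hξ₀; linarith
  refine ⟨a, by rwa [hnorm], ξ₀, hrU ξ₀ hξ₀r, hZξ₀,
    deriv_ne_zero_of_coLipschitz hco hξ₀ (hZat ξ₀ hξ₀r), fun ξ hξU hZξ => ?_⟩
  -- uniqueness of the preimage: it lies beyond radius `r'`, where `Z` is co-Lipschitz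
  have hξr : r' < ‖ξ‖ := by
    by_contra h
    have h' := hB ξ hξU (not_lt.1 h)
    rw [hZξ, hnorm] at h'
    linarith
  have h := hco ξ ξ₀ hξr hξ₀
  rw [hZξ, hZξ₀, sub_self, norm_zero, mul_zero] at h
  exact sub_eq_zero.1 (norm_le_zero_iff.1 h)

end Analysis

/-! ### Relative properness of the first flat coordinate over the exterior of a disc -/

variable {S : HomotopySphere 4} {p : S.carrier} {ε' : ℝ}

/-- **Relative properness of `Z` over `A_R`.** For `0 < ε'` with the closed `ε'`-ball inside the
chart target, `u : ℂ → Σ∖p` continuous, `Z = (Ycoord p ∘ u).1` continuous on `U = u⁻¹(B_{ε'})` with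
`Z ξ − ξ → 0` at infinity, and `ε'⁻¹ < R`: for every compact `K ⊆ A_R = {R < ‖z‖}` the set
`U_R ∩ Z⁻¹ K` (`U_R = {ξ ∈ U | R < ‖Z ξ‖}`) is compact. It is bounded because `‖Z ξ − ξ‖ < 1` off a
compact set while `Z ξ ∈ K` is bounded, and closed because it coincides with `C ∩ Z⁻¹ K` for the
closed set `C = u⁻¹(closed chart ball of radius R⁻¹) ⊆ U` (`‖e(u ξ) − e p‖ < R⁻¹ < ε'` on it,
`inBall_of_inv_lt_norm_fst_Ycoord`), on which `Z` is continuous. -/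
theorem isCompact_inter_preimage_of_subset {u : ℂ → punctured p} (hε' : 0 < ε')
    (hball : Metric.closedBall (extChartAt (𝓡 4) p p) ε' ⊆ (extChartAt (𝓡 4) p).target)
    (hu : Continuous u)
    (hZcont : ContinuousOn (fun ξ : ℂ => (Ycoord p (u ξ)).1)
      {ξ : ℂ | InPuncturedChartBall p ε' (u ξ)})
    (hlim : Tendsto (fun ξ : ℂ => (Ycoord p (u ξ)).1 - ξ) (cocompact ℂ) (𝓝 0))
    {R : ℝ} (hR : ε'⁻¹ < R) {K : Set ℂ} (hKA : K ⊆ {z : ℂ | R < ‖z‖}) (hK : IsCompact K) :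
    IsCompact ({ξ : ℂ | InPuncturedChartBall p ε' (u ξ) ∧ R < ‖(Ycoord p (u ξ)).1‖} ∩
      (fun ξ : ℂ => (Ycoord p (u ξ)).1) ⁻¹' K) := by
  have hR₀ : 0 < R := (inv_pos.2 hε').trans hR
  have hRε : R⁻¹ < ε' := (inv_lt_comm₀ hε' hR₀).1 hR
  set e := extChartAt (𝓡 4) p with he
  set U : Set ℂ := {ξ | InPuncturedChartBall p ε' (u ξ)} with hU_def
  set Z : ℂ → ℂ := fun ξ => (Ycoord p (u ξ)).1 with hZ_def
  -- the closed set `C = u⁻¹(closed chart ball of radius R⁻¹) ⊆ U`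
  set C : Set ℂ := {ξ | (u ξ).1 ∈ (chartAt (EuclideanSpace ℝ (Fin 4)) p).source ∧
    e (u ξ).1 ∈ Metric.closedBall (e p) R⁻¹} with hC_def
  have hball' : Metric.closedBall (e p) R⁻¹ ⊆ e.target :=
    (Metric.closedBall_subset_closedBall hRε.le).trans hball
  have hCclosed : IsClosed C :=
    (isClosed_closedChartBall p hball').preimage (continuous_subtype_val.comp hu)
  have hCU : C ⊆ U := fun ξ hξ => ⟨hξ.1, Metric.closedBall_subset_ball hRε hξ.2⟩
  have hset : {ξ : ℂ | InPuncturedChartBall p ε' (u ξ) ∧ R < ‖Z ξ‖} ∩ Z ⁻¹' K = C ∩ Z ⁻¹' K := by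
    ext ξ
    constructor
    · rintro ⟨⟨hξU, hξR⟩, hξK⟩
      exact ⟨⟨hξU.1, Metric.ball_subset_closedBall
        (inBall_of_inv_lt_norm_fst_Ycoord hξU (inv_pos.2 hR₀) (by rwa [inv_inv])).2⟩, hξK⟩
    · rintro ⟨hξC, hξK⟩
      exact ⟨⟨hCU hξC, hKA hξK⟩, hξK⟩
  rw [hset]
  refine Metric.isCompact_of_isClosed_isBounded
    ((hZcont.mono hCU).preimage_isClosed_of_isClosed hCclosed hK.isClosed) ?_
  -- boundedness: `‖Z ξ - ξ‖ < 1` off a compact set, and `‖Z ξ‖` is bounded on `Z⁻¹ K`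
  obtain ⟨M, hM⟩ := hK.isBounded.exists_norm_le
  have hev : ∀ᶠ ξ in cocompact ℂ, Z ξ - ξ ∈ Metric.ball (0 : ℂ) 1 :=
    hlim.eventually (Metric.isOpen_ball.mem_nhds (Metric.mem_ball_self one_pos))
  obtain ⟨C', hC', hC'sub⟩ := mem_cocompact'.1 hev
  refine (hC'.isBounded.union (Metric.isBounded_closedBall (x := (0 : ℂ)) (r := M + 1))).subset
    fun ξ hξ => ?_
  by_cases hξC' : ξ ∈ C'
  · exact Or.inl hξC'
  · refine Or.inr (mem_closedBall_zero_iff.2 ?_)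
    have h1 : Z ξ - ξ ∈ Metric.ball (0 : ℂ) 1 := by
      by_contra h
      exact hξC' (hC'sub h)
    rw [mem_ball_zero_iff] at h1
    have h2 : ‖Z ξ‖ ≤ M := hM _ hξ.2
    calc ‖ξ‖ = ‖Z ξ - (Z ξ - ξ)‖ := by rw [sub_sub_cancel]
      _ ≤ ‖Z ξ‖ + ‖Z ξ - ξ‖ := norm_sub_le _ _
      _ ≤ M + 1 := by linarith

end MemberGraph

/-! ### The helper -/

/-- **Graph structure of a pencil member over the exterior of a disc, given degree theory
((P3)(a) of line `Sketch`).** Assume the degree-theoretic fact: a holomorphic `Z : U → A` between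
open sets, `A` preconnected, relatively proper over `A`, with one value having a single simple
preimage, is a bijection `U → A` with `Z' ≠ 0`. Then for `J` standard on the punctured
`ε'`-chart-ball at `p`, a pencil member `u` (`IsPencilMember J u b`) and `R > ε'⁻¹`, the first flat
coordinate `Z ξ = (Ycoord p (u ξ)).1` maps `U_R = {ξ ∈ u⁻¹(B_{ε'}) | R < ‖Z ξ‖}` bijectively onto
`A_R = {R < ‖z‖}` with nowhere vanishing derivative. The seven inputs: `U_R` open and `Z`
holomorphic (`helper_endHolomorphic`), `A_R` open and preconnected
(`AreaThm.isConnected_setOf_lt_norm`), `Z(U_R) ⊆ A_R`, relative properness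
(`MemberGraph.isCompact_inter_preimage_of_subset`), and the simple far fibre
(`MemberGraph.exists_simpleFibre_of_tendsto` with `helper_memberEventuallyInBall` and
`exists_norm_fst_Ycoord_le_of_norm_le`). -/
theorem helper_memberGraph_of :
    (∀ (Z : ℂ → ℂ) (U A : Set ℂ), IsOpen U → IsOpen A → IsPreconnected A →
      DifferentiableOn ℂ Z U → MapsTo Z U A →
      (∀ K ⊆ A, IsCompact K → IsCompact (U ∩ Z ⁻¹' K)) →
      (∃ a₀ ∈ A, ∃ ξ₀ ∈ U, Z ξ₀ = a₀ ∧ deriv Z ξ₀ ≠ 0 ∧ ∀ ξ ∈ U, Z ξ = a₀ → ξ = ξ₀) →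
      BijOn Z U A ∧ ∀ ξ ∈ U, deriv Z ξ ≠ 0) →
    ∀ (S : HomotopySphere 4) (p : S.carrier)
      (J : ∀ x : punctured p, TangentSpace (𝓡 4) x →L[ℝ] TangentSpace (𝓡 4) x) (ε' : ℝ)
      (u : ℂ → punctured p) (b : ℂ),
      0 < ε' →
      Metric.closedBall (extChartAt (𝓡 4) p p) ε' ⊆ (extChartAt (𝓡 4) p).target →
      (∀ x : punctured p, InPuncturedChartBall p ε' x →
        ∀ (v : TangentSpace (𝓡 4) x) (b : EuclideanSpace ℝ (Fin 4)),
          inner ℝ (fderiv ℝ inversion (extChartAt (𝓡 4) p x.1 - extChartAt (𝓡 4) p p)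
            (mfderiv (𝓡 4) 𝓘(ℝ, EuclideanSpace ℝ (Fin 4))
              (fun z : punctured p => extChartAt (𝓡 4) p z.1) x (J x v))) b
          = stdSymplecticForm (fderiv ℝ inversion (extChartAt (𝓡 4) p x.1 - extChartAt (𝓡 4) p p)
            (mfderiv (𝓡 4) 𝓘(ℝ, EuclideanSpace ℝ (Fin 4))
              (fun z : punctured p => extChartAt (𝓡 4) p z.1) x v)) b) →
      IsPencilMember J u b →
      ∀ R : ℝ, ε'⁻¹ < R →
        BijOn (fun ξ : ℂ => (Ycoord p (u ξ)).1)
          {ξ : ℂ | InPuncturedChartBall p ε' (u ξ) ∧ R < ‖(Ycoord p (u ξ)).1‖} {z : ℂ | R < ‖z‖} ∧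
        ∀ ξ : ℂ, InPuncturedChartBall p ε' (u ξ) → R < ‖(Ycoord p (u ξ)).1‖ →
          deriv (fun ξ : ℂ => (Ycoord p (u ξ)).1) ξ ≠ 0 := by
  intro hdeg S p J ε' u b hε' hball hJstd hu R hR
  -- E0: `U = u⁻¹(B_{ε'})` is open and `Ycoord ∘ u` is holomorphic on it
  obtain ⟨hUopen, hYdiff, -, -⟩ :=
    helper_endHolomorphic S p J ε' hε' hball hJstd u hu.1.contMDiff hu.1.isJHolomorphic
  have hucont : Continuous u := hu.1.contMDiff.continuous
  have hlim : Tendsto (fun ξ : ℂ => (Ycoord p (u ξ)).1 - ξ) (cocompact ℂ) (𝓝 0) := hu.2.2.2.2.1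
  have hZdiff : DifferentiableOn ℂ (fun ξ : ℂ => (Ycoord p (u ξ)).1)
      {ξ : ℂ | InPuncturedChartBall p ε' (u ξ)} := hYdiff.fst
  -- (1) `U_R` is open
  have h1 : IsOpen {ξ : ℂ | InPuncturedChartBall p ε' (u ξ) ∧ R < ‖(Ycoord p (u ξ)).1‖} :=
    hZdiff.continuousOn.norm.isOpen_inter_preimage hUopen isOpen_Ioi
  -- (2), (3) `A_R` is open and preconnected
  have h2 : IsOpen {z : ℂ | R < ‖z‖} := isOpen_lt continuous_const continuous_norm
  have h3 : IsPreconnected {z : ℂ | R < ‖z‖} :=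
    (Literature.Analysis.Complex.AreaThm.isConnected_setOf_lt_norm R).isPreconnected
  -- (4), (5) `Z` is holomorphic on `U_R ⊆ U` and maps it into `A_R`
  have h4 : DifferentiableOn ℂ (fun ξ : ℂ => (Ycoord p (u ξ)).1)
      {ξ : ℂ | InPuncturedChartBall p ε' (u ξ) ∧ R < ‖(Ycoord p (u ξ)).1‖} :=
    hZdiff.mono fun ξ hξ => hξ.1
  have h5 : MapsTo (fun ξ : ℂ => (Ycoord p (u ξ)).1)
      {ξ : ℂ | InPuncturedChartBall p ε' (u ξ) ∧ R < ‖(Ycoord p (u ξ)).1‖} {z : ℂ | R < ‖z‖} :=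
    fun ξ hξ => hξ.2
  -- (6) relative properness over `A_R`
  have h6 : ∀ K ⊆ {z : ℂ | R < ‖z‖}, IsCompact K →
      IsCompact ({ξ : ℂ | InPuncturedChartBall p ε' (u ξ) ∧ R < ‖(Ycoord p (u ξ)).1‖} ∩
        (fun ξ : ℂ => (Ycoord p (u ξ)).1) ⁻¹' K) := fun K hKA hK =>
    MemberGraph.isCompact_inter_preimage_of_subset hε' hball hucont hZdiff.continuousOn hlim hR
      hKA hK
  -- (7) the simple far fibre
  have h7 : ∃ a₀ ∈ {z : ℂ | R < ‖z‖},
      ∃ ξ₀ ∈ {ξ : ℂ | InPuncturedChartBall p ε' (u ξ) ∧ R < ‖(Ycoord p (u ξ)).1‖},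
        (Ycoord p (u ξ₀)).1 = a₀ ∧ deriv (fun ξ : ℂ => (Ycoord p (u ξ)).1) ξ₀ ≠ 0 ∧
        ∀ ξ ∈ {ξ : ℂ | InPuncturedChartBall p ε' (u ξ) ∧ R < ‖(Ycoord p (u ξ)).1‖},
          (Ycoord p (u ξ)).1 = a₀ → ξ = ξ₀ := by
    obtain ⟨r, hr⟩ := helper_memberEventuallyInBall S p J u b hu ε' hε'
    obtain ⟨a₀, ha₀, ξ₀, hξ₀U, hZξ₀, hd, huniq⟩ := MemberGraph.exists_simpleFibre_of_tendsto hUopen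
      hZdiff hr hlim (exists_norm_fst_Ycoord_le_of_norm_le ε' hucont) R
    refine ⟨a₀, ha₀, ξ₀, ⟨hξ₀U, ?_⟩, hZξ₀, hd, fun ξ hξ hZξ => huniq ξ hξ.1 hZξ⟩
    show R < ‖(Ycoord p (u ξ₀)).1‖
    rwa [hZξ₀]
  obtain ⟨hbij, hder⟩ := hdeg _ _ _ h1 h2 h3 h4 h5 h6 h7
  exact ⟨hbij, fun ξ hξ₁ hξ₂ => hder ξ ⟨hξ₁, hξ₂⟩⟩

end Summit.SmoothPoincare4.SmoothPoincare4.Theorems.WitnessCharge.PencilIncompleteness
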